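import Summits.CriticalPhenomena.PercolationContinuityZ3.Theorems.SahiAEOrthantCorollaries

/-!
# The structure theorem in every dimension on the open unit cube: positive inside, zero outside

Support file of the Sahi cell (`prim-sahi`, typer seat, generation 23; `--supports stmt-CriticalPhenomena-4575`).
Theorems only (no definitions, no named facts, no sorries).

The all-dimensions analogue of `SahiAEPlaneSquare.lean` (typer g22, the open unit square), now available because the
structure theorem holds on `ℝ^ι` for every finite `ι` (`exists_measurable_mtp2_version_of_ae_unbounded'`):

* `exists_measurable_mtp2_version_of_ae_cube` — `f : ℝ^ι → [0,∞]` measurable with `0 < f < ∞` a.e. on the open unit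
  cube `U = (0,1)^ι` and MTP₂ on `λ|_U ⊗ λ|_U`-a.e. pair (no bounds; e.g. copula densities) has a measurable version
  `F = f` a.e. on `U` with `0 < F < ∞` ON `U`, `F = 0` off `U`, and `F(x) F(y) ≤ F(x ∧ y) F(x ∨ y)` at EVERY pair of
  `ℝ^ι` (coordinatewise sigmoid / logit transport, extension by `0`);
* `exists_measurable_supermodular_version_of_ae_cube` — additive form: a measurable `φ` supermodular on
  `λ|_U ⊗ λ|_U`-a.e. pair has a measurable `ψ = φ` a.e. on `U`, supermodular at every pair OF `U` (optimal:
  `Plane.no_real_supermodular_version_neg_div`).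

No sorries, no new axioms.
-/

noncomputable section

namespace Summit.CriticalPhenomena.PercolationContinuityZ3.Theorems.SahiAEFourFunctions

open MeasureTheory Set Filter Topology Function
open scoped ENNReal NNReal

variable {ι : Type*} [Fintype ι]

/-- `sigmoid (log (v * (1 - v)⁻¹)) = v` on `(0,1)`. [folklore] -/
private theorem sigmoid_log_div₅ {v : ℝ} (hv : v ∈ Ioo (0 : ℝ) 1) : Real.sigmoid (Real.log (v * (1 - v)⁻¹)) = v := by
  have hv0 : 0 < v := hv.1
  have hv1 : 0 < 1 - v := by linarith [hv.2]
  rw [Real.sigmoid_def, Real.exp_neg, Real.exp_log (mul_pos hv0 (inv_pos.2 hv1))]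
  field_simp
  ring

/-- `log (sigmoid x / (1 - sigmoid x)) = x`. [folklore] -/
private theorem log_div_sigmoid₅ (x : ℝ) : Real.log (Real.sigmoid x * (1 - Real.sigmoid x)⁻¹) = x :=
  Real.sigmoid_injective (sigmoid_log_div₅ ⟨Real.sigmoid_pos x, Real.sigmoid_lt_one x⟩)

/-- The logit is monotone on `(0,1)`. [folklore] -/
private theorem log_div_le_log_div₅ {u v : ℝ} (hu : u ∈ Ioo (0 : ℝ) 1) (hv : v ∈ Ioo (0 : ℝ) 1) (huv : u ≤ v) :
    Real.log (u * (1 - u)⁻¹) ≤ Real.log (v * (1 - v)⁻¹) := by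
  rw [← Real.sigmoid_le_iff, sigmoid_log_div₅ hu, sigmoid_log_div₅ hv]
  exact huv

/-- **The structure theorem on the open unit cube `(0,1)^ι`, multiplicative form** (e.g. copula densities, every
dimension): `0 < F < ∞` on the open cube, `F = 0` outside, MTP₂ at every pair of `ℝ^ι`. [this work] -/
theorem exists_measurable_mtp2_version_of_ae_cube (f : (ι → ℝ) → ℝ≥0∞) (hf : Measurable f)
    (hfin : ∀ᵐ x ∂(volume : Measure (ι → ℝ)).restrict (Set.pi univ fun _ => Ioo (0 : ℝ) 1), f x ≠ 0 ∧ f x ≠ ∞)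
    (hMTP : ∀ᵐ p : (ι → ℝ) × (ι → ℝ)
      ∂((volume : Measure (ι → ℝ)).restrict (Set.pi univ fun _ => Ioo (0 : ℝ) 1)).prod
        ((volume : Measure (ι → ℝ)).restrict (Set.pi univ fun _ => Ioo (0 : ℝ) 1)),
      f p.1 * f p.2 ≤ f (p.1 ⊓ p.2) * f (p.1 ⊔ p.2)) :
    ∃ F : (ι → ℝ) → ℝ≥0∞, Measurable F ∧
      (∀ x ∈ Set.pi univ (fun _ : ι => Ioo (0 : ℝ) 1), F x ≠ 0 ∧ F x ≠ ∞) ∧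
      (∀ x ∉ Set.pi univ (fun _ : ι => Ioo (0 : ℝ) 1), F x = 0) ∧
      F =ᵐ[(volume : Measure (ι → ℝ)).restrict (Set.pi univ fun _ => Ioo (0 : ℝ) 1)] f ∧
      ∀ x y, F x * F y ≤ F (x ⊓ y) * F (x ⊔ y) := by
  set U : Set (ι → ℝ) := Set.pi univ fun _ => Ioo (0 : ℝ) 1 with hU
  have mU : MeasurableSet U := MeasurableSet.univ_pi fun _ => measurableSet_Ioo
  set e : (ι → ℝ) → (ι → ℝ) := fun x i => Real.sigmoid (x i) with he
  set L : (ι → ℝ) → (ι → ℝ) := fun y i => Real.log (y i * (1 - y i)⁻¹) with hL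
  have he_meas : Measurable e :=
    measurable_pi_iff.2 fun i => continuous_sigmoid.measurable.comp (measurable_pi_apply i)
  have hL_meas : Measurable L :=
    measurable_pi_iff.2 fun i => Real.measurable_log.comp
      ((measurable_pi_apply i).mul (measurable_const.sub (measurable_pi_apply i)).inv)
  have he_mem : ∀ x, e x ∈ U := fun x => Set.mem_univ_pi.2 fun i => ⟨Real.sigmoid_pos _, Real.sigmoid_lt_one _⟩
  have hLe : ∀ x, L (e x) = x := fun x => funext fun i => log_div_sigmoid₅ (x i)
  have heL : ∀ y ∈ U, e (L y) = y := fun y hy => funext fun i => sigmoid_log_div₅ (Set.mem_univ_pi.1 hy i)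
  have he_diff : Differentiable ℝ e :=
    differentiable_pi.2 fun i => differentiable_sigmoid.comp (differentiable_apply i)
  have hL_diff : DifferentiableOn ℝ L U := by
    refine differentiableOn_pi.2 fun i => ?_
    have h1 : DifferentiableOn ℝ (fun y : ι → ℝ => y i) U := (differentiable_apply i).differentiableOn
    have h2 : DifferentiableOn ℝ (fun y : ι → ℝ => 1 - y i) U :=
      ((differentiable_const (1 : ℝ)).sub (differentiable_apply i)).differentiableOn
    refine (h1.mul (h2.inv fun y hy => ?_)).log fun y hy => ?_
    · have := (Set.mem_univ_pi.1 hy i).2; linarith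
    · have h0 := (Set.mem_univ_pi.1 hy i).1
      have h1' : 0 < 1 - y i := by have := (Set.mem_univ_pi.1 hy i).2; linarith
      exact (mul_pos h0 (inv_pos.2 h1')).ne'
  -- null sets both ways
  have hν : (volume : Measure (ι → ℝ)).restrict U ≪ (volume : Measure (ι → ℝ)).map e := by
    refine Measure.AbsolutelyContinuous.mk fun s hs h0 => ?_
    rw [Measure.map_apply he_meas hs] at h0
    rw [Measure.restrict_apply hs]
    have hsub : s ∩ U ⊆ e '' (e ⁻¹' s) := fun y hy => ⟨L y, by
      show e (L y) ∈ s
      rw [heL y hy.2]; exact hy.1, heL y hy.2⟩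
    exact measure_mono_null hsub
      (addHaar_image_eq_zero_of_differentiableOn_of_addHaar_eq_zero volume he_diff.differentiableOn h0)
  have hν' : (volume : Measure (ι → ℝ)).map e ≪ (volume : Measure (ι → ℝ)).restrict U := by
    refine Measure.AbsolutelyContinuous.mk fun s hs h0 => ?_
    rw [Measure.restrict_apply hs] at h0
    rw [Measure.map_apply he_meas hs]
    have hsub : e ⁻¹' s ⊆ L '' (s ∩ U) := fun x hx => ⟨e x, ⟨hx, he_mem x⟩, hLe x⟩
    exact measure_mono_null hsub
      (addHaar_image_eq_zero_of_differentiableOn_of_addHaar_eq_zero volume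
        (hL_diff.mono Set.inter_subset_right) h0)
  have hUinf : ∀ x ∈ U, ∀ y ∈ U, x ⊓ y ∈ U := fun x hx y hy => Set.mem_univ_pi.2 fun i =>
    ⟨lt_min (Set.mem_univ_pi.1 hx i).1 (Set.mem_univ_pi.1 hy i).1,
      (min_le_left _ _).trans_lt (Set.mem_univ_pi.1 hx i).2⟩
  have hUsup : ∀ x ∈ U, ∀ y ∈ U, x ⊔ y ∈ U := fun x hx y hy => Set.mem_univ_pi.2 fun i =>
    ⟨(Set.mem_univ_pi.1 hx i).1.trans_le (le_max_left _ _),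
      max_lt (Set.mem_univ_pi.1 hx i).2 (Set.mem_univ_pi.1 hy i).2⟩
  have helat : ∀ x y, e (x ⊓ y) = e x ⊓ e y ∧ e (x ⊔ y) = e x ⊔ e y := fun x y =>
    ⟨funext fun i => Real.sigmoid_monotone.map_inf (x i) (y i),
      funext fun i => Real.sigmoid_monotone.map_sup (x i) (y i)⟩
  have hLlat : ∀ x ∈ U, ∀ y ∈ U, L (x ⊓ y) = L x ⊓ L y ∧ L (x ⊔ y) = L x ⊔ L y := by
    intro x hx y hy
    have hmono : MonotoneOn (fun v : ℝ => Real.log (v * (1 - v)⁻¹)) (Ioo (0 : ℝ) 1) :=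
      fun u hu v hv huv => log_div_le_log_div₅ hu hv huv
    refine ⟨funext fun i => ?_, funext fun i => ?_⟩
    · exact hmono.map_inf (Set.mem_univ_pi.1 hx i) (Set.mem_univ_pi.1 hy i)
    · exact hmono.map_sup (Set.mem_univ_pi.1 hx i) (Set.mem_univ_pi.1 hy i)
  -- pull back to `ℝ^ι` and apply the structure theorem
  have hqmp : Measure.QuasiMeasurePreserving e volume ((volume : Measure (ι → ℝ)).restrict U) := ⟨he_meas, hν'⟩
  have hqmp2 := MeasureTheory.QuasiMeasurePreserving.prodMap hqmp hqmp
  have hfin' : ∀ᵐ x ∂(volume : Measure (ι → ℝ)), f (e x) ≠ 0 ∧ f (e x) ≠ ∞ := hqmp.ae hfin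
  have hMTP' : ∀ᵐ p : (ι → ℝ) × (ι → ℝ) ∂((volume : Measure (ι → ℝ)).prod volume),
      (f ∘ e) p.1 * (f ∘ e) p.2 ≤ (f ∘ e) (p.1 ⊓ p.2) * (f ∘ e) (p.1 ⊔ p.2) := by
    filter_upwards [hqmp2.ae hMTP] with p hp
    simp only [Function.comp_apply, (helat p.1 p.2).1, (helat p.1 p.2).2]
    exact hp
  obtain ⟨F'', hF''m, hF''b, hF''ae, hF''mtp⟩ :=
    exists_measurable_mtp2_version_of_ae_unbounded' (f ∘ e) (hf.comp he_meas) hfin' hMTP'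
  refine ⟨U.indicator (F'' ∘ L), (hF''m.comp hL_meas).indicator mU, fun x hx => ?_, fun x hx => ?_, ?_, fun x y => ?_⟩
  · rw [Set.indicator_of_mem hx]; exact hF''b (L x)
  · exact Set.indicator_of_notMem hx _
  · have h1 : ∀ᵐ x ∂(volume : Measure (ι → ℝ)), F'' (L (e x)) = f (e x) := by
      filter_upwards [hF''ae] with x hx
      rw [hLe x]; exact hx
    have h2 : ∀ᵐ y ∂(volume : Measure (ι → ℝ)).map e, F'' (L y) = f y :=
      (ae_map_iff he_meas.aemeasurable (measurableSet_eq_fun (hF''m.comp hL_meas) hf)).2 h1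
    have h3 : ∀ᵐ y ∂(volume : Measure (ι → ℝ)).restrict U, F'' (L y) = f y := hν.ae_le h2
    filter_upwards [h3, ae_restrict_mem mU] with y hy hyU
    rw [Set.indicator_of_mem hyU, Function.comp_apply, hy]
  · by_cases hx : x ∈ U
    · by_cases hy : y ∈ U
      · rw [Set.indicator_of_mem hx, Set.indicator_of_mem hy, Set.indicator_of_mem (hUinf x hx y hy),
          Set.indicator_of_mem (hUsup x hx y hy)]
        simp only [Function.comp_apply]
        rw [(hLlat x hx y hy).1, (hLlat x hx y hy).2]
        exact hF''mtp (L x) (L y)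
      · rw [Set.indicator_of_notMem hy, mul_zero]; exact zero_le
    · rw [Set.indicator_of_notMem hx, zero_mul]; exact zero_le

/-- **The structure theorem on the open unit cube, additive form**: the version is supermodular at every pair OF the
open cube (and, by `SahiAEPlaneSharpness`, in general not beyond). [this work] -/
theorem exists_measurable_supermodular_version_of_ae_cube (φ : (ι → ℝ) → ℝ) (hφ : Measurable φ)
    (hsm : ∀ᵐ p : (ι → ℝ) × (ι → ℝ)
      ∂((volume : Measure (ι → ℝ)).restrict (Set.pi univ fun _ => Ioo (0 : ℝ) 1)).prod
        ((volume : Measure (ι → ℝ)).restrict (Set.pi univ fun _ => Ioo (0 : ℝ) 1)),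
      φ p.1 + φ p.2 ≤ φ (p.1 ⊓ p.2) + φ (p.1 ⊔ p.2)) :
    ∃ ψ : (ι → ℝ) → ℝ, Measurable ψ ∧
      ψ =ᵐ[(volume : Measure (ι → ℝ)).restrict (Set.pi univ fun _ => Ioo (0 : ℝ) 1)] φ ∧
      ∀ x ∈ Set.pi univ (fun _ : ι => Ioo (0 : ℝ) 1), ∀ y ∈ Set.pi univ (fun _ : ι => Ioo (0 : ℝ) 1),
        ψ x + ψ y ≤ ψ (x ⊓ y) + ψ (x ⊔ y) := by
  set U : Set (ι → ℝ) := Set.pi univ fun _ => Ioo (0 : ℝ) 1 with hU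
  set f : (ι → ℝ) → ℝ≥0∞ := fun x => ENNReal.ofReal (Real.exp (φ x)) with hfdef
  have hfm : Measurable f := ENNReal.measurable_ofReal.comp (Real.measurable_exp.comp hφ)
  have hfin : ∀ᵐ x ∂(volume : Measure (ι → ℝ)).restrict U, f x ≠ 0 ∧ f x ≠ ∞ :=
    Eventually.of_forall fun x => ⟨(ENNReal.ofReal_pos.2 (Real.exp_pos _)).ne', ENNReal.ofReal_ne_top⟩
  have hMTP : ∀ᵐ p : (ι → ℝ) × (ι → ℝ) ∂((volume : Measure (ι → ℝ)).restrict U).prod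
      ((volume : Measure (ι → ℝ)).restrict U), f p.1 * f p.2 ≤ f (p.1 ⊓ p.2) * f (p.1 ⊔ p.2) := by
    filter_upwards [hsm] with p hp
    simp only [hfdef]
    rw [← ENNReal.ofReal_mul (Real.exp_pos _).le, ← ENNReal.ofReal_mul (Real.exp_pos _).le, ← Real.exp_add,
      ← Real.exp_add]
    exact ENNReal.ofReal_le_ofReal (Real.exp_le_exp.2 hp)
  obtain ⟨F, hFm, hFU, -, hFf, hFmtp⟩ := exists_measurable_mtp2_version_of_ae_cube f hfm hfin hMTP
  have hUinf : ∀ x ∈ U, ∀ y ∈ U, x ⊓ y ∈ U := fun x hx y hy => Set.mem_univ_pi.2 fun i =>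
    ⟨lt_min (Set.mem_univ_pi.1 hx i).1 (Set.mem_univ_pi.1 hy i).1,
      (min_le_left _ _).trans_lt (Set.mem_univ_pi.1 hx i).2⟩
  have hUsup : ∀ x ∈ U, ∀ y ∈ U, x ⊔ y ∈ U := fun x hx y hy => Set.mem_univ_pi.2 fun i =>
    ⟨(Set.mem_univ_pi.1 hx i).1.trans_le (le_max_left _ _),
      max_lt (Set.mem_univ_pi.1 hx i).2 (Set.mem_univ_pi.1 hy i).2⟩
  have hFpos : ∀ x ∈ U, 0 < (F x).toReal := fun x hx => ENNReal.toReal_pos (hFU x hx).1 (hFU x hx).2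
  refine ⟨fun x => Real.log (F x).toReal, Real.measurable_log.comp (ENNReal.measurable_toReal.comp hFm), ?_,
    fun x hx y hy => ?_⟩
  · filter_upwards [hFf] with x hx
    show Real.log (F x).toReal = φ x
    rw [hx, hfdef, ENNReal.toReal_ofReal (Real.exp_pos _).le, Real.log_exp]
  · have h := hFmtp x y
    have hL : (F x * F y).toReal ≤ (F (x ⊓ y) * F (x ⊔ y)).toReal :=
      ENNReal.toReal_mono (ENNReal.mul_ne_top (hFU _ (hUinf x hx y hy)).2 (hFU _ (hUsup x hx y hy)).2) h
    rw [ENNReal.toReal_mul, ENNReal.toReal_mul] at hL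
    rw [← Real.log_mul (hFpos x hx).ne' (hFpos y hy).ne',
      ← Real.log_mul (hFpos _ (hUinf x hx y hy)).ne' (hFpos _ (hUsup x hx y hy)).ne']
    exact Real.log_le_log (mul_pos (hFpos x hx) (hFpos y hy)) hL

end Summit.CriticalPhenomena.PercolationContinuityZ3.Theorems.SahiAEFourFunctions
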